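import Literature.AnabelianGeometry.SemiGraphs.QuasiTemperoidsQDPairs
import HarnessLib

/-!
# Semi-graphs of anabelioids, Appendix: quasi-temperoids — Definition A.3 (iv), the composition claim (proof)

Mochizuki, *Semi-graphs of anabelioids*, Publ. RIMS **42** (2006), Appendix, Definition A.3 (iv),
manuscript p. 82 [cite: MochizukiSemiAnbd2006, Def A.3(iv) p.82]: "[Thus, under the 1-properness
assumption, one verifies immediately that if `B → C` forms a quotient of `(B, Γ_B)`, then the composite
arrow `A → B → C` forms a quotient of `(A, Γ_A)`.]"  PROOF-ONLY companion of `QuasiTemperoidsQDPairs.lean`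
(abc-iut-L3-t2; no definitions here): the named fact `QDPair.OneProperCompQuotient` is DISCHARGED
(`QDPair.OneProperCompQuotient_holds`).

The printed "one verifies immediately" is a diagram chase that uses only the universal properties and
holds in ANY category, without the connected-quasi-temperoid hypothesis and without the 0-properness
clause of 1-properness (`QDPair.isQuotient_comp_of_isOneProper`): an arrow `χ : A → D` invariant under
`Γ_A` is in particular invariant under `Ker(Γ_A ↠ Γ_B) = Stab_{Γ_A}(φ)`, so it factors uniquely through
the quotient `φ : A → B` of `(A, Ker)` as `χ = φ ≫ χ'`; the surjectivity clause of 1-properness ("every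
`γ_B` has a `γ_A` over it") and the uniqueness of `χ'` make `χ'` invariant under `Γ_B`, so `χ'` factors
uniquely through the quotient `ψ : B → C`; the two uniqueness clauses compose.  Nothing here takes a side
on [IUTchIII] Cor. 3.12.
-/

open CategoryTheory

namespace Literature.AnabelianGeometry.SemiGraphs

namespace QDPair

universe v₁ u u₁

variable {Q : Type u₁} [Category.{v₁} Q]

/-- A morphism of QD-pairs `φ : (A, Γ_A) → (B, Γ_B)` followed by a `Γ_B`-invariant arrow is
`Γ_A`-invariant ("`γ_B ∘ φ = φ ∘ γ_A`", Def. A.3 (ii)). [cite: MochizukiSemiAnbd2006, Def A.3(ii) p.82] -/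
theorem Hom.comp_invariant {P₁ P₂ : QDPair Q} (f : Hom P₁ P₂) {C : Q} (ψ : P₂.A ⟶ C)
    (hψ : ∀ γ' ∈ P₂.Γ, γ'.hom ≫ ψ = ψ) : ∀ γ ∈ P₁.Γ, γ.hom ≫ (f.hom ≫ ψ) = f.hom ≫ ψ := by
  intro γ hγ
  obtain ⟨γ', hγ', h⟩ := f.comm γ hγ
  rw [← Category.assoc, ← h, Category.assoc, hψ γ' hγ']

/-- For a 1-proper `φ : (A, Γ_A) → (B, Γ_B)`, a `Γ_A`-invariant arrow `χ : A → D` factors UNIQUELY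
through `φ`, and the factor `χ' : B → D` is `Γ_B`-invariant (the factorisation comes from "`A → B` forms
a quotient of `(A, Ker(Γ_A ↠ Γ_B))`", the invariance from "the associated homomorphism `Γ_A → Γ_B` is
surjective" and uniqueness). [cite: MochizukiSemiAnbd2006, Def A.3(iv) p.82] -/
theorem Hom.IsOneProper.existsUnique_factor {P₁ P₂ : QDPair Q} {f : Hom P₁ P₂} (hf : f.IsOneProper)
    {D : Q} (χ : P₁.A ⟶ D) (hχ : ∀ γ ∈ P₁.Γ, γ.hom ≫ χ = χ) :
    ∃! χ' : P₂.A ⟶ D, f.hom ≫ χ' = χ ∧ ∀ γ' ∈ P₂.Γ, γ'.hom ≫ χ' = χ' := by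
  obtain ⟨-, hsurj, hquot⟩ := hf
  -- `χ` is invariant under `Ker(Γ_A ↠ Γ_B) ⊆ Γ_A`, hence factors uniquely through `φ`
  obtain ⟨χ', hχ', huniq⟩ := hquot.2 χ fun γ hγ => hχ γ hγ.1
  refine ⟨χ', ⟨hχ', fun γ' hγ' => ?_⟩, fun χ'' hχ'' => huniq χ'' hχ''.1⟩
  -- invariance under `Γ_B`: lift `γ_B` to some `γ_A` and use the uniqueness of the factorisation
  obtain ⟨γ, hγ, h⟩ := hsurj γ' hγ'
  have key : f.hom ≫ (γ'.hom ≫ χ') = χ := by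
    rw [← Category.assoc, h, Category.assoc, hχ', hχ γ hγ]
  exact (huniq (γ'.hom ≫ χ') key).trans (huniq χ' hχ').symm

/-- **Definition A.3 (iv), the bracketed claim, in ANY category**: if `φ : (A, Γ_A) → (B, Γ_B)` is
1-proper and `ψ : B → C` forms a quotient of `(B, Γ_B)`, then `φ ≫ ψ : A → C` forms a quotient of
`(A, Γ_A)` ("one verifies immediately", p. 82 — the verification uses neither the quasi-temperoid
structure nor 0-properness). [cite: MochizukiSemiAnbd2006, Def A.3(iv) p.82] -/
theorem isQuotient_comp_of_isOneProper {P₁ P₂ : QDPair Q} (f : Hom P₁ P₂) (hf : f.IsOneProper)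
    {C : Q} (ψ : P₂.A ⟶ C) (hψ : P₂.IsQuotient ψ) : P₁.IsQuotient (f.hom ≫ ψ) := by
  refine ⟨f.comp_invariant ψ hψ.1, fun D χ hχ => ?_⟩
  obtain ⟨χ', ⟨hχ', hinv⟩, huniq⟩ := hf.existsUnique_factor χ hχ
  obtain ⟨χ'', hχ'', huniq''⟩ := hψ.2 χ' hinv
  refine ⟨χ'', ?_, fun κ hκ => ?_⟩
  · change (f.hom ≫ ψ) ≫ χ'' = χ
    rw [Category.assoc, hχ'', hχ']
  · change (f.hom ≫ ψ) ≫ κ = χ at hκ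
    rw [Category.assoc] at hκ
    exact huniq'' κ (huniq (ψ ≫ κ) ⟨hκ, fun γ' hγ' => by rw [← Category.assoc, hψ.1 γ' hγ']⟩)

/-- **Definition A.3 (iv), bracket** (SemiAnbd Appendix p. 82), the named fact `QDPair.OneProperCompQuotient`
of `QuasiTemperoidsQDPairs.lean` DISCHARGED: in a connected quasi-temperoid, for a 1-proper morphism of
QD-pairs `(A, Γ_A) → (B, Γ_B)` and a quotient `B → C` of `(B, Γ_B)`, the composite `A → B → C` forms a
quotient of `(A, Γ_A)` (an instance of `isQuotient_comp_of_isOneProper`, which needs no hypothesis on the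
category). [cite: MochizukiSemiAnbd2006, Def A.3(iv) p.82] -/
theorem OneProperCompQuotient_holds :
    Literature.AnabelianGeometry.SemiGraphs.QDPair.OneProperCompQuotient.{v₁, u, u₁} :=
  fun _ _ _ _ _ f hf _ ψ hψ => isQuotient_comp_of_isOneProper f hf ψ hψ

end QDPair

end Literature.AnabelianGeometry.SemiGraphs
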